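import Mathlib
import Literature.Computability.AlgebraicComplexity.GroupTheoreticMatMul

/-!
# The count for clustered-chart STPP designs — stub `stub_rowsCount` of line `registered`
(clustered-charts reshape; crux `EisensteinValCertificates.HomocyclicSTPPDesigns`,
stmt-MatrixMultiplication-10647)

Pure `rpow` bookkeeping, the STPP family is passed through unchanged.  Two displayed hypotheses
(proved by neighbouring stubs) are taken as data:

* corner-free squares (Behrend): for every `η > 0` and all large `D`, a subset `S ⊆ ℤ_D × ℤ_D`
  of size `≥ D^{2−η}` free of the pattern `{(x,y),(x+δ,y),(x+δ,y−δ)}`, `δ ≠ 0`;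
* rows ⟹ designs: for every `t` and every such corner-free `S ⊆ ℤ_{d^t} × ℤ_{d^t}`, an STPP family
  (tree `IsSTPP`) of `L ≥ m^{3t}·#S` triples in `(ℤ/p)^{3t}`, each of volume `(ab)^{3t}`.

From the MERIT `m·d^{2/3}·(ab)^{(2+ε)/3} > p` (with `ab ≥ 2`, `d ≥ 1`) we get designs in
`(ℤ/p)^{3t}` beating the exponent `2+2ε`: with `x := ab`,
`p^{3t} < m^{3t} d^{2t} x^{t(2+ε)} ≤ m^{3t}·#S·x^{tε}·x^{t(2+ε)} ≤ L·x^{t(2+2ε)} = Σ_u (vol u)^{(2+2ε)/3}`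
as soon as `d^{2t} ≤ #S·x^{tε}`; for `d = 1` take `t = 1`, `S = {(0,0)}`; for `d ≥ 2` take
`η := ε·log x / log d` (so `(d^t)^η = x^{tε}`), `t := D₀ + 1` (so `D₀ ≤ d^t`) and the Behrend square
`S ⊆ ℤ_{d^t}²` with `(d^t)^{2−η} ≤ #S`.

Not here: the corner-free squares, the rows ⟹ designs theorem, and the existence of clustered SDPP
families with merit (the line's open leaf); all three are other stubs of the skeleton.
-/

set_option linter.dupNamespace false
-- (single-conjunct summit: the namespace repeats `MatrixMultiplication`)

namespace Summit.MatrixMultiplication.MatrixMultiplication.Theorems.HomocyclicSTPPDesigns.ClusteredCharts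

open Literature.Computability.AlgebraicComplexity Finset
open scoped BigOperators

/-- The real-analysis core of the count: from the merit `p < m·d^{2/3}·x^{(2+ε)/3}`, a square of
`c` cells with `d^{2t} ≤ c·x^{tε}` and `L ≥ m^{3t}·c` triples of volume `x^{3t}` each (`t ≥ 1`,
`x ≥ 2`), the packing sum `L·(x^{3t})^{(2+2ε)/3}` exceeds `p^{3t}`. [folklore] -/
private theorem rowsCount_arith {p m x d t c L : ℕ} {ε : ℝ} (hx : 2 ≤ x) (ht : 1 ≤ t)
    (hmerit : (p : ℝ) < (m : ℝ) * (d : ℝ) ^ ((2 : ℝ) / 3) * (x : ℝ) ^ ((2 + ε) / 3))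
    (hc : (d : ℝ) ^ (2 * t) ≤ (c : ℝ) * (x : ℝ) ^ ((t : ℝ) * ε))
    (hL : m ^ (3 * t) * c ≤ L) :
    (p : ℝ) ^ (3 * t) < (L : ℝ) * ((x ^ (3 * t) : ℕ) : ℝ) ^ ((2 + 2 * ε) / 3) := by
  have hX : (0 : ℝ) < x := by exact_mod_cast (show 0 < x by omega)
  have hd0 : (0 : ℝ) ≤ d := Nat.cast_nonneg d
  have hp0 : (0 : ℝ) ≤ p := Nat.cast_nonneg p
  -- `p^{3t} < M^{3t}`
  have h1 : (p : ℝ) ^ (3 * t) <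
      ((m : ℝ) * (d : ℝ) ^ ((2 : ℝ) / 3) * (x : ℝ) ^ ((2 + ε) / 3)) ^ (3 * t) :=
    pow_lt_pow_left₀ hmerit hp0 (by omega)
  -- `M^{3t} = m^{3t} · d^{2t} · x^{t(2+ε)}`
  have hdpow : ((d : ℝ) ^ ((2 : ℝ) / 3)) ^ (3 * t) = (d : ℝ) ^ (2 * t) := by
    rw [← Real.rpow_natCast ((d : ℝ) ^ ((2 : ℝ) / 3)) (3 * t), ← Real.rpow_mul hd0,
      ← Real.rpow_natCast (d : ℝ) (2 * t)]
    congr 1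
    push_cast
    ring
  have hxpow : ((x : ℝ) ^ ((2 + ε) / 3)) ^ (3 * t) = (x : ℝ) ^ ((t : ℝ) * (2 + ε)) := by
    rw [← Real.rpow_natCast ((x : ℝ) ^ ((2 + ε) / 3)) (3 * t), ← Real.rpow_mul hX.le]
    congr 1
    push_cast
    ring
  have h2 : ((m : ℝ) * (d : ℝ) ^ ((2 : ℝ) / 3) * (x : ℝ) ^ ((2 + ε) / 3)) ^ (3 * t) =
      (m : ℝ) ^ (3 * t) * (d : ℝ) ^ (2 * t) * (x : ℝ) ^ ((t : ℝ) * (2 + ε)) := by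
    rw [mul_pow, mul_pow, hdpow, hxpow]
  -- `(x^{3t})^{(2+2ε)/3} = x^{t(2+ε)} · x^{tε}`
  have h3 : ((x ^ (3 * t) : ℕ) : ℝ) ^ ((2 + 2 * ε) / 3) =
      (x : ℝ) ^ ((t : ℝ) * (2 + ε)) * (x : ℝ) ^ ((t : ℝ) * ε) := by
    rw [← Real.rpow_add hX, Nat.cast_pow, ← Real.rpow_natCast (x : ℝ) (3 * t),
      ← Real.rpow_mul hX.le]
    congr 1
    push_cast
    ring
  have hL' : (m : ℝ) ^ (3 * t) * (c : ℝ) ≤ (L : ℝ) := by exact_mod_cast hL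
  have hXpow : (0 : ℝ) ≤ (x : ℝ) ^ ((t : ℝ) * (2 + ε)) := Real.rpow_nonneg hX.le _
  have hXpow' : (0 : ℝ) ≤ (x : ℝ) ^ ((t : ℝ) * ε) := Real.rpow_nonneg hX.le _
  have hm0 : (0 : ℝ) ≤ (m : ℝ) ^ (3 * t) := pow_nonneg (Nat.cast_nonneg m) _
  calc (p : ℝ) ^ (3 * t)
      < ((m : ℝ) * (d : ℝ) ^ ((2 : ℝ) / 3) * (x : ℝ) ^ ((2 + ε) / 3)) ^ (3 * t) := h1
    _ = (m : ℝ) ^ (3 * t) * (d : ℝ) ^ (2 * t) * (x : ℝ) ^ ((t : ℝ) * (2 + ε)) := h2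
    _ ≤ (m : ℝ) ^ (3 * t) * ((c : ℝ) * (x : ℝ) ^ ((t : ℝ) * ε)) *
          (x : ℝ) ^ ((t : ℝ) * (2 + ε)) :=
        mul_le_mul_of_nonneg_right (mul_le_mul_of_nonneg_left hc hm0) hXpow
    _ = (m : ℝ) ^ (3 * t) * (c : ℝ) *
          ((x : ℝ) ^ ((t : ℝ) * (2 + ε)) * (x : ℝ) ^ ((t : ℝ) * ε)) := by ring
    _ ≤ (L : ℝ) * ((x : ℝ) ^ ((t : ℝ) * (2 + ε)) * (x : ℝ) ^ ((t : ℝ) * ε)) :=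
        mul_le_mul_of_nonneg_right hL' (mul_nonneg hXpow hXpow')
    _ = (L : ℝ) * ((x ^ (3 * t) : ℕ) : ℝ) ^ ((2 + 2 * ε) / 3) := by rw [h3]

/-- **The count** (registered stub `stub_rowsCount` of line `registered`, clustered-charts reshape;
size M, pure `rpow` bookkeeping — the STPP family is passed through unchanged): corner-free squares
of size `D^{2−η}` (first hypothesis) and rows ⟹ designs at every width `3t` (second hypothesis)
turn the MERIT `m·d^{2/3}·(ab)^{(2+ε)/3} > p` into STPP designs in `(ℤ/p)^{3t}` beating `2+2ε`:
with `D = d^t`, `L·(ab)^{t(2+2ε)} ≥ m^{3t} D^{2−η} (ab)^{t(2+2ε)} ≥ m^{3t} d^{2t} (ab)^{t(2+ε)} > p^{3t}`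
as soon as `D^η ≤ (ab)^{tε}` (`d = 1`: `t = 1`, `S = {(0,0)}`; `d ≥ 2`: `η = ε·log(ab)/log d`,
`t = D₀ + 1`).  The witness is `ℓ := 3t`, `N := L`. [folklore] -/
theorem stub_rowsCount :
    (∀ η : ℝ, 0 < η → ∃ D₀ : ℕ, ∀ D ≥ D₀, ∃ S : Finset (ZMod D × ZMod D),
      (∀ x y δ : ZMod D, (x, y) ∈ S → (x + δ, y) ∈ S → (x + δ, y - δ) ∈ S → δ = 0) ∧
      (D : ℝ) ^ (2 - η) ≤ S.card) →
    ∀ (p m a b d : ℕ), 2 ≤ a * b → 1 ≤ d →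
      (∀ (t : ℕ) (S : Finset (ZMod (d ^ t) × ZMod (d ^ t))),
        (∀ x y δ : ZMod (d ^ t), (x, y) ∈ S → (x + δ, y) ∈ S → (x + δ, y - δ) ∈ S → δ = 0) →
        ∃ (L : ℕ) (A' B' C' : Fin L → Finset (Fin (3 * t) → ZMod p)),
          IsSTPP A' B' C' ∧ m ^ (3 * t) * S.card ≤ L ∧
          ∀ u, (A' u).card * (B' u).card * (C' u).card = (a * b) ^ (3 * t)) →
      ∀ ε : ℝ, 0 < ε →
      (p : ℝ) < (m : ℝ) * (d : ℝ) ^ ((2 : ℝ) / 3) * ((a * b : ℕ) : ℝ) ^ ((2 + ε) / 3) →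
      ∃ (ℓ N : ℕ) (A' B' C' : Fin N → Finset (Fin ℓ → ZMod p)),
        IsSTPP A' B' C' ∧ (p : ℝ) ^ ℓ <
          ∑ u, (((A' u).card * (B' u).card * (C' u).card : ℕ) : ℝ) ^ ((2 + 2 * ε) / 3) := by
  intro hCF p m a b d hab hd hDes ε hε hmerit
  have hX1 : (1 : ℝ) < ((a * b : ℕ) : ℝ) := by exact_mod_cast (show 1 < a * b by omega)
  have hXpos : (0 : ℝ) < ((a * b : ℕ) : ℝ) := one_pos.trans hX1
  -- a width `t ≥ 1` and a corner-free square `S ⊆ ℤ_{d^t}²` with `d^{2t} ≤ #S · (ab)^{tε}`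
  obtain ⟨t, ht, S, hScf, hSc⟩ : ∃ t : ℕ, 1 ≤ t ∧ ∃ S : Finset (ZMod (d ^ t) × ZMod (d ^ t)),
      (∀ x y δ : ZMod (d ^ t), (x, y) ∈ S → (x + δ, y) ∈ S → (x + δ, y - δ) ∈ S → δ = 0) ∧
      (d : ℝ) ^ (2 * t) ≤ (S.card : ℝ) * ((a * b : ℕ) : ℝ) ^ ((t : ℝ) * ε) := by
    obtain rfl | hd2 := eq_or_lt_of_le hd
    · -- `d = 1`: the one-cell square
      refine ⟨1, le_rfl, {(0, 0)}, ?_, ?_⟩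
      · intro x y δ hxy hxδ _
        rw [Finset.mem_singleton, Prod.mk.injEq] at hxy hxδ
        rw [hxy.1, zero_add] at hxδ
        exact hxδ.1
      · rw [Finset.card_singleton]
        simp only [Nat.cast_one, one_pow, one_mul]
        exact Real.one_le_rpow hX1.le hε.le
    · -- `d ≥ 2`: a Behrend square of side `d^t`
      have hdR : (1 : ℝ) < d := by exact_mod_cast hd2
      have hdpos : (0 : ℝ) < d := one_pos.trans hdR
      have hlogd : 0 < Real.log d := Real.log_pos hdR
      have hlogX : 0 < Real.log ((a * b : ℕ) : ℝ) := Real.log_pos hX1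
      obtain ⟨D₀, hD₀⟩ := hCF (ε * Real.log ((a * b : ℕ) : ℝ) / Real.log d)
        (div_pos (mul_pos hε hlogX) hlogd)
      have ht_lt : D₀ + 1 < d ^ (D₀ + 1) := Nat.lt_pow_self hd2
      obtain ⟨S, hScf, hSc⟩ := hD₀ (d ^ (D₀ + 1)) (by omega)
      refine ⟨D₀ + 1, by omega, S, hScf, ?_⟩
      have hDt : (0 : ℝ) < (d : ℝ) ^ (D₀ + 1) := pow_pos hdpos _
      -- `(d^t)^η ≤ (ab)^{tε}` (in fact equality)
      have hkey : ((d : ℝ) ^ (D₀ + 1)) ^ (ε * Real.log ((a * b : ℕ) : ℝ) / Real.log d) ≤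
          ((a * b : ℕ) : ℝ) ^ (((D₀ + 1 : ℕ) : ℝ) * ε) := by
        rw [← Real.rpow_natCast (d : ℝ) (D₀ + 1), ← Real.rpow_mul hdpos.le,
          Real.rpow_def_of_pos hdpos, Real.rpow_def_of_pos hXpos, Real.exp_le_exp]
        have hηlog : ε * Real.log ((a * b : ℕ) : ℝ) / Real.log d * Real.log d =
            ε * Real.log ((a * b : ℕ) : ℝ) := div_mul_cancel₀ _ hlogd.ne'
        have h : Real.log d * (((D₀ + 1 : ℕ) : ℝ) * (ε * Real.log ((a * b : ℕ) : ℝ) / Real.log d)) =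
            Real.log ((a * b : ℕ) : ℝ) * (((D₀ + 1 : ℕ) : ℝ) * ε) := by
          rw [show Real.log d * (((D₀ + 1 : ℕ) : ℝ) * (ε * Real.log ((a * b : ℕ) : ℝ) / Real.log d)) =
              ((D₀ + 1 : ℕ) : ℝ) * (ε * Real.log ((a * b : ℕ) : ℝ) / Real.log d * Real.log d) by ring,
            hηlog]
          ring
        exact h.le
      -- `d^{2t} = (d^t)^{2-η} · (d^t)^η`
      have hsplit : (d : ℝ) ^ (2 * (D₀ + 1)) =
          ((d : ℝ) ^ (D₀ + 1)) ^ (2 - ε * Real.log ((a * b : ℕ) : ℝ) / Real.log d) *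
            ((d : ℝ) ^ (D₀ + 1)) ^ (ε * Real.log ((a * b : ℕ) : ℝ) / Real.log d) := by
        rw [← Real.rpow_add hDt, sub_add_cancel, Real.rpow_two]
        ring
      have hSc' : ((d : ℝ) ^ (D₀ + 1)) ^ (2 - ε * Real.log ((a * b : ℕ) : ℝ) / Real.log d) ≤
          (S.card : ℝ) := by
        rw [← Nat.cast_pow]
        exact hSc
      rw [hsplit]
      exact mul_le_mul hSc' hkey (Real.rpow_nonneg hDt.le _) (Nat.cast_nonneg _)
  -- the designs at width `3t`
  obtain ⟨L, A', B', C', hSTPP, hL, hvol⟩ := hDes t S hScf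
  refine ⟨3 * t, L, A', B', C', hSTPP, ?_⟩
  have hsum : ∑ u, (((A' u).card * (B' u).card * (C' u).card : ℕ) : ℝ) ^ ((2 + 2 * ε) / 3) =
      ∑ _u : Fin L, (((a * b) ^ (3 * t) : ℕ) : ℝ) ^ ((2 + 2 * ε) / 3) :=
    Finset.sum_congr rfl fun u _ => by rw [hvol u]
  rw [hsum, Finset.sum_const, Finset.card_univ, Fintype.card_fin, nsmul_eq_mul]
  exact rowsCount_arith hab ht hmerit hSc hL

end Summit.MatrixMultiplication.MatrixMultiplication.Theorems.HomocyclicSTPPDesigns.ClusteredCharts
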